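import Summits.BirchSwinnertonDyer.BirchSwinnertonDyer.Theorems.ManinLocalTwoThreeStevensFormulaOfTranslates
import Summits.BirchSwinnertonDyer.BirchSwinnertonDyer.Theorems.ManinLocalTwoThreeStevensCurveTes75OfSlashConj
import Summits.BirchSwinnertonDyer.BirchSwinnertonDyer.Theorems.ManinLocalTwoThreeStevensYPresentation
import Summits.BirchSwinnertonDyer.BirchSwinnertonDyer.Theorems.ManinLocalTwoThreeKummerDiamondStepTwoCyclotomic
import Literature.NumberTheory.ModularForms.GammaTranslatesGaloisAction
import Literature.NumberTheory.EllipticCurves.ModularCurveGammaIndex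
import Literature.FieldTheory.AlgClosed.AutComplexFiniteIndex
import HarnessLib

/-!
# The values of an `X₁(N)`-parametrisation at the cusps of the `∞`-fibre are RATIONAL points
(route `ManinLocalTwoThree`, crux C2 stmt-BirchSwinnertonDyer-22967; cell bsd-f2-manin, prover p2 gen 23; es g41d's fact request
F-es-207 `StevensInfinityFibreCuspRational` / E-es-207′ `Gamma1OptimalPeriodsRational` for data of Manin constant `1`, PROVED, no optimality used)

Let `D` be an `X₁(N)`-datum of an elliptic `W/ℚ` (`π = D.uniformize`, `Λ = Λ(D.L)`, `f = D.f`) with `D.c = 1`, and let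
`γ = (a b; c δ) ∈ Γ₀(N)` with `c ≠ 0` (so `N ∣ c`: the cusp `γ∞ = a/c` lies in the fibre of `X₁(N) → X₀(N)` over `∞`).  Then for every
`σ ∈ Aut(ℂ/ℚ)`, `σ(π({∞, a/c}_f)) = π({∞, a/c}_f)` (`map_uniformize_cuspSymbol_eq_self`), hence `π({∞, a/c}_f)` is the base change of a
`ℚ`-rational point of `W` (`exists_ratPoint_eq_uniformize_cuspSymbol`); since `Λ₀(f)` IS the set of the cusp-to-cusp periods `{∞, γ∞}_f`,
`γ ∈ Γ₀(N)` (`coe_periodLattice_eq_range`), **every `z ∈ Λ₀(f)` uniformises to a rational point** (`exists_ratPoint_eq_uniformize_of_mem_periodLattice`),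
which is es g41d's E-es-207′ `Gamma1OptimalPeriodsRational` VERBATIM (`gamma1OptimalPeriodsRational`; its `IsOptimal` hypothesis is idle) and the
`c_D = 1` case of F-es-207 (`stevensInfinityFibreCuspRational_of_c_eq_one`).  With es's kernel-checked glue `primeLevel_rung_ledger'`
(HOME/es/g41/Sketch-es-g41d.lean §10) the prime-level rung of the Derickx–Orlić question then rests on the Miyawaki–Setzer torsion fact E-es-208 alone.

PROOF (Stevens 1982 Thm. 1.3.1 (b) at the `∞`-fibre, run on `q_N`-expansions of translates).  Write `σ(e^{2πi/N}) = e^{2πid/N}`, `dd′ ≡ 1 (N)`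
(`StepTwo.exists_inv_pair_of_algEquiv`).  The matrix `γ′ = γ·T^t`, `t = δ(d−1)b`, has the SAME first column `(a, c)` — so `γ′∞ = γ∞ = a/c` — and
satisfies `γ′ ≡ (a, db; d′c, δ) (mod N)` (because `N ∣ c` and `aδ ≡ 1`), the congruence shape of the LEAD's Galois law on translates
`Literature.NumberTheory.ModularForms.qExpansion_slash_conj` (p766634).  That law, for CUSP FORMS on `Γ₁(N)` with rational Fourier coefficients
(`qExpansion_slash_conj_of_rat_cuspCoeff`, the `CuspForm`/`cuspCoeff` adapter = p3's binder `hSC` of p766900 discharged: `slashConj_holds`), applied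
to p3's rational presenting pairs `(F₁, G₁)` of `℘_Λ(ℰ_f)` and `(Fʸ, Gʸ)` of `℘′_Λ(ℰ_f)` (`StevensCurve.exists_rat_gamma1_presentation_of_gamma1Datum_one`,
`exists_gamma1_yPresentation`), feeds p2's transport of cusp values along translates (`map_uniformize_cuspValue_of_galois_on_translates₂`, the
two-weight form of p766969's assembly over p766339's `coeff_slash_eq_(deriv)weierstrassP_mul`), giving `σ(π({∞,γ∞})) = π({∞,γ′∞}) = π({∞,γ∞})`.
Descent `Fix(Aut(ℂ/ℚ)) = ℚ` (`Literature.FieldTheory.AlgClosed.Complex.mem_of_forall_mem_fixingSubgroup`) turns `σ`-fixed points of `W(ℂ)` into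
rational points (`exists_ratPoint_of_forall_map_eq`).

HONEST FRAMING: unconditional and fact-free (no modularity, no CDT); restricted to data with `D.c = 1` (the general-`c` form of F-es-207 needs the
presentations for the lattice `c⁻¹Λ`); nothing about C2/C3, Manin's conjecture or BSD is proved here.  No definitions, no sorry.
[cite: Stevens1982, §1.3 Thm. 1.3.1 (a), (b) (p. 13)] [cite: ShimuraIATAF1971, §6.2 Prop. 6.9] [cite: Manin1972, Prop. 1.4 and Thm. 1.9]
[cite: ConradEdixhovenStein2003, §6.1.2] [cite: Lang2002, Ch. VIII §1]
-/

set_option autoImplicit false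
-- lint-debt: the directory name repeats the summit name (sibling precedent `ManinLocalTwoThreeStevensFormulaOfTranslates.lean`)
set_option linter.dupNamespace false

noncomputable section

open scoped MatrixGroups ModularForm Topology PeriodPair
open Complex Filter Function CongruenceSubgroup WeierstrassCurve PowerSeries
open UpperHalfPlane hiding I
open Literature.NumberTheory.EllipticCurves Literature.NumberTheory.EllipticCurves.ModularForms

namespace Summit.BirchSwinnertonDyer.BirchSwinnertonDyer.Theorems.ManinLocalTwoThree.CuspValues

variable {N : ℕ} [NeZero N]

/-! ## §1 The Galois law on translates for rational cusp forms on `Γ₁(N)` (adapter to `qExpansion_slash_conj`) -/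

/-- **STEP (1) for cusp forms on `Γ₁(N)` with rational Fourier coefficients.**  For `F ∈ S_k(Γ₁(N))` with `aₙ(F) ∈ ℚ`, a ring endomorphism
`σ` of `ℂ` with `σ(e^{2πi/N}) = e^{2πid/N}`, `dd′ ≡ 1 (N)`, and `γ, γ′ ∈ SL₂(ℤ)` with `γ′ ≡ (a, db; d′c, δ) (mod N)` where `γ = (a b; c δ)`:
`qExpansion_N(F ∣ γ′) = σ ∘ qExpansion_N(F ∣ γ)` (the LEAD's `qExpansion_slash_conj`, with `S_k(Γ₁(N)) ⊆ M_k(Γ(N))` and the `σ`-fixed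
`q_N`-expansion of a rational `q`-expansion). [cite: ShimuraIATAF1971, §6.2 Prop. 6.9] [cite: Stevens1982, §1.3] -/
theorem qExpansion_slash_conj_of_rat_cuspCoeff {k : ℤ} (F : CuspForm (Gamma1 N) k) (hrat : ∀ n, ∃ q : ℚ, (q : ℂ) = cuspCoeff F n)
    (σ : ℂ →+* ℂ) {d d' : ℤ} (hσ : σ (Complex.exp (2 * Real.pi * Complex.I / N)) = Complex.exp (2 * Real.pi * Complex.I * d / N))
    (hdd : ((d * d' : ℤ) : ZMod N) = 1) {γ γ' : SL(2, ℤ)}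
    (h00 : ((γ' 0 0 : ℤ) : ZMod N) = ((γ 0 0 : ℤ) : ZMod N)) (h01 : ((γ' 0 1 : ℤ) : ZMod N) = (d : ZMod N) * ((γ 0 1 : ℤ) : ZMod N))
    (h10 : ((γ' 1 0 : ℤ) : ZMod N) = (d' : ZMod N) * ((γ 1 0 : ℤ) : ZMod N)) (h11 : ((γ' 1 1 : ℤ) : ZMod N) = ((γ 1 1 : ℤ) : ZMod N)) :
    qExpansion ((N : ℕ) : ℝ) (⇑F ∣[k] γ') = (qExpansion ((N : ℕ) : ℝ) (⇑F ∣[k] γ)).map σ := by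
  set A : ModularForm (Gamma1 N) k := ModularFormClass.modularForm F with hA
  have hcoe : (⇑A : ℍ → ℂ) = ⇑F := rfl
  have hmem : (⇑F : ℍ → ℂ) ∈ formSpace (CongruenceSubgroup.Gamma N : Subgroup (GL (Fin 2) ℝ)) k := by
    rw [← hcoe]
    exact formSpace_mono (Subgroup.map_mono (Gamma_le_Gamma1 N)) (coe_mem_formSpace A)
  have hfix : (qExpansion ((N : ℕ) : ℝ) (⇑F : ℍ → ℂ)).map σ = qExpansion ((N : ℕ) : ℝ) ⇑F := by
    rw [← hcoe]
    exact StevensGalois.map_qExpansion_nat_eq_self_of_rat A (fun n ↦ by obtain ⟨q, hq⟩ := hrat n; exact ⟨q, hq.symm⟩) σ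
  exact Literature.NumberTheory.ModularForms.qExpansion_slash_conj σ hσ hdd hmem hfix h00 h01 h10 h11

/-- **The binder `hSC` of p3's `StevensCurve.Tes75_of_modularity_slashConj` (p766900), DISCHARGED** — exact-entry form: for `F ∈ S_k(Γ₁(N))`
with rational Fourier coefficients, `σ ∈ Aut(ℂ/ℚ)` with `σ(e^{2πi/N}) = e^{2πid/N}`, `dd′ ≡ 1 (N)`, and `g′ = (a, db; d′c, δ)`, `g = (a b; c δ)`:
`coeff_n(F ∣ g′) = σ(coeff_n(F ∣ g))` for all `n`. [cite: ShimuraIATAF1971, §6.2 Prop. 6.9] [cite: Stevens1982, §1.3 Thm. 1.3.1] -/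
theorem slashConj_holds (N : ℕ) [NeZero N] (k : ℤ) (F : CuspForm (Gamma1 N) k) (hrat : ∀ n, ∃ q : ℚ, (q : ℂ) = cuspCoeff F n)
    (σ : ℂ ≃ₐ[ℚ] ℂ) (d d' : ℤ) (hdd : ((d * d' : ℤ) : ZMod N) = 1)
    (hσ : σ (Complex.exp (2 * Real.pi * Complex.I / N)) = Complex.exp (2 * Real.pi * Complex.I * d / N))
    (g g' : SL(2, ℤ)) (h00 : (g' 0 0 : ℤ) = g 0 0) (h11 : (g' 1 1 : ℤ) = g 1 1) (h01 : (g' 0 1 : ℤ) = d * g 0 1)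
    (h10 : (g' 1 0 : ℤ) = d' * g 1 0) (n : ℕ) :
    (qExpansion ((N : ℕ) : ℝ) (⇑F ∣[k] g')).coeff n = σ ((qExpansion ((N : ℕ) : ℝ) (⇑F ∣[k] g)).coeff n) := by
  have h := qExpansion_slash_conj_of_rat_cuspCoeff F hrat (σ : ℂ →+* ℂ) hσ hdd (γ := g) (γ' := g')
    (by rw [h00]) (by rw [h01]; push_cast; ring) (by rw [h10]; push_cast; ring) (by rw [h11])
  rw [h, coeff_map]
  rfl

/-! ## §2 Transport of cusp values along translates, two weights -/

/-- **Stevens' formula from a Galois action on coefficients of translates** — the two-weight form of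
`map_uniformize_cuspValue_of_galois_on_translates` (the `x`-pair `(F, G)` in weight `kx`, the `y`-pair `(Fy, Gy)` in weight `ky`).  For a period pair
`L` with uniformisation `u` of `W(ℂ)` (kernel `Λ(L)`, explicit coordinates off `Λ(L)`), `f ∈ S₂(Γ₀(N))`, `c ≠ 0`, presentations `G·℘_L(cℰ_f) = F`,
`Gy·℘′_L(cℰ_f) = Fy` by cusp forms on `Γ₁(N)`, matrices `g, g′` with `g₁₀, g′₁₀ ≠ 0`, and `σ ∈ Aut(ℂ/ℚ)` carrying the `q_N`-coefficients of the four
translates by `g` to those by `g′`: `σ(u(c{∞, g∞}_f)) = u(c{∞, g′∞}_f)`. [cite: Stevens1982, §1.3 Thm. 1.3.1 (b)] [cite: ShimuraIATAF1971, §6.2 Prop. 6.9] -/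
theorem map_uniformize_cuspValue_of_galois_on_translates₂ {W : WeierstrassCurve ℚ} [W.IsElliptic] {kx ky : ℤ}
    (L : PeriodPair) (u : ℂ →+ (W.baseChange ℂ).toAffine.Point) (hker : (u.ker : Set ℂ) = L.lattice)
    (hspec : ∀ z ∉ L.lattice, ∃ h, u z = .some (W' := (W.baseChange ℂ).toAffine)
      (℘[L] z - (W.baseChange ℂ).b₂ / 12)
      ((℘'[L] z - (W.baseChange ℂ).a₁ * (℘[L] z - (W.baseChange ℂ).b₂ / 12) - (W.baseChange ℂ).a₃) / 2) h)
    (f : CuspForm (Gamma0 N) 2) (hf : f ≠ 0) {c : ℂ} (hc : c ≠ 0)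
    (F G : CuspForm (Gamma1 N) kx) (Fy Gy : CuspForm (Gamma1 N) ky) (hG0 : (⇑G : ℍ → ℂ) ≠ 0) (hGy0 : (⇑Gy : ℍ → ℂ) ≠ 0)
    (hpresX : ∀ τ : ℍ, c * eichlerIntegral f τ ∉ L.lattice → G τ * ℘[L] (c * eichlerIntegral f τ) = F τ)
    (hpresY : ∀ τ : ℍ, c * eichlerIntegral f τ ∉ L.lattice → Gy τ * ℘'[L] (c * eichlerIntegral f τ) = Fy τ)
    (g g' : SL(2, ℤ)) (hg : (g 1 0 : ℤ) ≠ 0) (hg' : (g' 1 0 : ℤ) ≠ 0) (σ : ℂ ≃ₐ[ℚ] ℂ)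
    (hσx : ∀ Φ : CuspForm (Gamma1 N) kx, (Φ = F ∨ Φ = G) → ∀ n : ℕ,
      σ ((qExpansion ((N : ℕ) : ℝ) (⇑Φ ∣[kx] g)).coeff n) = (qExpansion ((N : ℕ) : ℝ) (⇑Φ ∣[kx] g')).coeff n)
    (hσy : ∀ Φ : CuspForm (Gamma1 N) ky, (Φ = Fy ∨ Φ = Gy) → ∀ n : ℕ,
      σ ((qExpansion ((N : ℕ) : ℝ) (⇑Φ ∣[ky] g)).coeff n) = (qExpansion ((N : ℕ) : ℝ) (⇑Φ ∣[ky] g')).coeff n) :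
    Affine.Point.map (W' := W) (σ : ℂ →ₐ[ℚ] ℂ) (u (c * modularSymbol f (((g 0 0 : ℤ) : ℚ) / ((g 1 0 : ℤ) : ℚ)))) =
      u (c * modularSymbol f (((g' 0 0 : ℤ) : ℚ) / ((g' 1 0 : ℤ) : ℚ))) := by
  set z₀ := c * modularSymbol f (((g 0 0 : ℤ) : ℚ) / ((g 1 0 : ℤ) : ℚ)) with hz₀
  set z₀' := c * modularSymbol f (((g' 0 0 : ℤ) : ℚ) / ((g' 1 0 : ℤ) : ℚ)) with hz₀'
  have hu0 : ∀ z, u z = 0 ↔ z ∈ L.lattice := fun z ↦ by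
    rw [← AddMonoidHom.mem_ker, ← SetLike.mem_coe, hker, SetLike.mem_coe]
  -- first non-vanishing coefficients of `G ∣ g`, `G ∣ g'` (the same index, by `σ`), and of `Gy ∣ g`, `Gy ∣ g'`
  obtain ⟨m, hGm, hGlt⟩ := exists_first_coeff_slash_ne_zero G hG0 g
  have hGm' : (qExpansion ((N : ℕ) : ℝ) (⇑G ∣[kx] g')).coeff m ≠ 0 := by
    rw [← hσx G (Or.inr rfl) m]; exact (map_ne_zero_iff _ σ.injective).mpr hGm
  have hGlt' : ∀ n < m, (qExpansion ((N : ℕ) : ℝ) (⇑G ∣[kx] g')).coeff n = 0 := fun n hn ↦ by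
    rw [← hσx G (Or.inr rfl) n, hGlt n hn, map_zero]
  obtain ⟨my, hGym, hGylt⟩ := exists_first_coeff_slash_ne_zero Gy hGy0 g
  have hGym' : (qExpansion ((N : ℕ) : ℝ) (⇑Gy ∣[ky] g')).coeff my ≠ 0 := by
    rw [← hσy Gy (Or.inr rfl) my]; exact (map_ne_zero_iff _ σ.injective).mpr hGym
  have hGylt' : ∀ n < my, (qExpansion ((N : ℕ) : ℝ) (⇑Gy ∣[ky] g')).coeff n = 0 := fun n hn ↦ by
    rw [← hσy Gy (Or.inr rfl) n, hGylt n hn, map_zero]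
  -- the cusp value is `O` on both sides or on neither
  have hiff : z₀ ∈ L.lattice ↔ z₀' ∈ L.lattice := by
    rw [hz₀, hz₀', mem_lattice_iff_exists_coeff_ne_zero f hf L F G hc hpresX g hg hGm hGlt,
      mem_lattice_iff_exists_coeff_ne_zero f hf L F G hc hpresX g' hg' hGm' hGlt']
    constructor
    · rintro ⟨n, hn, hne⟩
      exact ⟨n, hn, by rw [← hσx F (Or.inl rfl) n]; exact (map_ne_zero_iff _ σ.injective).mpr hne⟩
    · rintro ⟨n, hn, hne⟩
      refine ⟨n, hn, fun h0 ↦ hne ?_⟩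
      rw [← hσx F (Or.inl rfl) n, h0, map_zero]
  have hσx' : ∀ Φ : CuspForm (Gamma1 N) kx, (Φ = F ∨ Φ = G) → ∀ n : ℕ,
      (σ : ℂ →ₐ[ℚ] ℂ) ((qExpansion ((N : ℕ) : ℝ) (⇑Φ ∣[kx] g)).coeff n) = (qExpansion ((N : ℕ) : ℝ) (⇑Φ ∣[kx] g')).coeff n :=
    fun Φ h n ↦ hσx Φ h n
  have hσy' : ∀ Φ : CuspForm (Gamma1 N) ky, (Φ = Fy ∨ Φ = Gy) → ∀ n : ℕ,
      (σ : ℂ →ₐ[ℚ] ℂ) ((qExpansion ((N : ℕ) : ℝ) (⇑Φ ∣[ky] g)).coeff n) = (qExpansion ((N : ℕ) : ℝ) (⇑Φ ∣[ky] g')).coeff n :=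
    fun Φ h n ↦ hσy Φ h n
  by_cases hmem : z₀ ∈ L.lattice
  · -- both values are `O`
    rw [(hu0 z₀).mpr hmem, (hu0 z₀').mpr (hiff.mp hmem), map_zero]
  · have hmem' : z₀' ∉ L.lattice := fun h ↦ hmem (hiff.mpr h)
    -- coordinates as coefficient ratios
    obtain ⟨-, hx⟩ := coeff_slash_eq_weierstrassP_mul f hf L F G hc hpresX g hg hmem hGm hGlt
    obtain ⟨-, hx'⟩ := coeff_slash_eq_weierstrassP_mul f hf L F G hc hpresX g' hg' hmem' hGm' hGlt'
    obtain ⟨-, hy⟩ := coeff_slash_eq_derivWeierstrassP_mul f hf L Fy Gy hc hpresY g hg hmem hGym hGylt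
    obtain ⟨-, hy'⟩ := coeff_slash_eq_derivWeierstrassP_mul f hf L Fy Gy hc hpresY g' hg' hmem' hGym' hGylt'
    have h℘ : (σ : ℂ →ₐ[ℚ] ℂ) (℘[L] z₀) = ℘[L] z₀' := by
      have e1 : ℘[L] z₀ = (qExpansion ((N : ℕ) : ℝ) (⇑F ∣[kx] g)).coeff m / (qExpansion ((N : ℕ) : ℝ) (⇑G ∣[kx] g)).coeff m := by
        rw [eq_div_iff hGm, ← hx]
      have e2 : ℘[L] z₀' = (qExpansion ((N : ℕ) : ℝ) (⇑F ∣[kx] g')).coeff m / (qExpansion ((N : ℕ) : ℝ) (⇑G ∣[kx] g')).coeff m := by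
        rw [eq_div_iff hGm', ← hx']
      rw [e1, e2, map_div₀, hσx' F (Or.inl rfl) m, hσx' G (Or.inr rfl) m]
    have h℘' : (σ : ℂ →ₐ[ℚ] ℂ) (℘'[L] z₀) = ℘'[L] z₀' := by
      have e1 : ℘'[L] z₀ = (qExpansion ((N : ℕ) : ℝ) (⇑Fy ∣[ky] g)).coeff my / (qExpansion ((N : ℕ) : ℝ) (⇑Gy ∣[ky] g)).coeff my := by
        rw [eq_div_iff hGym, ← hy]
      have e2 : ℘'[L] z₀' = (qExpansion ((N : ℕ) : ℝ) (⇑Fy ∣[ky] g')).coeff my / (qExpansion ((N : ℕ) : ℝ) (⇑Gy ∣[ky] g')).coeff my := by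
        rw [eq_div_iff hGym', ← hy']
      rw [e1, e2, map_div₀, hσy' Fy (Or.inl rfl) my, hσy' Gy (Or.inr rfl) my]
    -- `σ` fixes the rational coefficients of the model
    have ha₁ : (σ : ℂ →ₐ[ℚ] ℂ) (W.baseChange ℂ).a₁ = (W.baseChange ℂ).a₁ := by
      rw [show (W.baseChange ℂ).a₁ = (W.a₁ : ℂ) by simp [WeierstrassCurve.baseChange, WeierstrassCurve.map_a₁]]
      exact map_ratCast _ _
    have ha₃ : (σ : ℂ →ₐ[ℚ] ℂ) (W.baseChange ℂ).a₃ = (W.baseChange ℂ).a₃ := by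
      rw [show (W.baseChange ℂ).a₃ = (W.a₃ : ℂ) by simp [WeierstrassCurve.baseChange, WeierstrassCurve.map_a₃]]
      exact map_ratCast _ _
    have hb₂ : (σ : ℂ →ₐ[ℚ] ℂ) (W.baseChange ℂ).b₂ = (W.baseChange ℂ).b₂ := by
      rw [show (W.baseChange ℂ).b₂ = (W.b₂ : ℂ) by simp [WeierstrassCurve.baseChange, WeierstrassCurve.map_b₂]]
      exact map_ratCast _ _
    -- the explicit points
    obtain ⟨hns, hP⟩ := hspec z₀ hmem
    obtain ⟨hns', hP'⟩ := hspec z₀' hmem'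
    rw [hP, hP', Affine.Point.map_some]
    simp only [Affine.Point.some.injEq]
    constructor <;> simp only [map_div₀, map_sub, map_mul, map_ofNat, h℘, h℘', ha₁, ha₃, hb₂]

/-! ## §3 Descent: `σ`-fixed points of `W(ℂ)` are rational points -/

/-- **`Fix(Aut(ℂ/ℚ)) = ℚ` on points**: a point of `W(ℂ)` fixed by every `σ ∈ Aut(ℂ/ℚ)` is the base change of a `ℚ`-rational point of `W`
(coordinatewise `Literature.FieldTheory.AlgClosed.Complex.mem_of_forall_mem_fixingSubgroup` with `E = ℚ`). [cite: Lang2002, Ch. VIII §1]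
[cite: SilvermanAEC2009, I.§1 and VIII.§1] -/
theorem exists_ratPoint_of_forall_map_eq {W : WeierstrassCurve ℚ} (Q : (W.baseChange ℂ).toAffine.Point)
    (hQ : ∀ σ : ℂ ≃ₐ[ℚ] ℂ, Affine.Point.map (W' := W) (σ : ℂ →ₐ[ℚ] ℂ) Q = Q) :
    ∃ P : (W.baseChange ℚ).toAffine.Point, Affine.Point.baseChange (W' := W) ℚ ℂ P = Q := by
  have eσ : ∀ (σ : ℂ ≃ₐ[ℚ] ℂ) (w : ℂ), (σ : ℂ →ₐ[ℚ] ℂ) w = σ w := fun _ _ ↦ rfl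
  have hrat : ∀ x : ℂ, (∀ σ : ℂ ≃ₐ[ℚ] ℂ, (σ : ℂ →ₐ[ℚ] ℂ) x = x) → ∃ q : ℚ, algebraMap ℚ ℂ q = x := fun x hx ↦ by
    have hmem : x ∈ (⊥ : IntermediateField ℚ ℂ) :=
      Literature.FieldTheory.AlgClosed.Complex.mem_of_forall_mem_fixingSubgroup ⊥ fun σ _ ↦ by rw [← eσ]; exact hx σ
    exact IntermediateField.mem_bot.mp hmem
  rcases Q with _ | ⟨x, y, h⟩
  · exact ⟨0, rfl⟩
  · have hxy : ∀ σ : ℂ ≃ₐ[ℚ] ℂ, (σ : ℂ →ₐ[ℚ] ℂ) x = x ∧ (σ : ℂ →ₐ[ℚ] ℂ) y = y := fun σ ↦ by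
      have h1 := hQ σ
      rw [Affine.Point.map_some] at h1
      simpa only [Affine.Point.some.injEq] using h1
    obtain ⟨x₀, rfl⟩ := hrat x fun σ ↦ (hxy σ).1
    obtain ⟨y₀, rfl⟩ := hrat y fun σ ↦ (hxy σ).2
    have h₀ : (W.baseChange ℚ).toAffine.Nonsingular x₀ y₀ :=
      (Affine.baseChange_nonsingular W (Algebra.ofId ℚ ℂ).injective x₀ y₀).mp h
    refine ⟨Affine.Point.some x₀ y₀ h₀, ?_⟩
    rfl

/-! ## §4 The `∞`-fibre: `σ`-fixedness and rationality of the cusp values of an `X₁(N)`-datum of Manin constant `1` -/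

/-- **`σ(π({∞, γ∞}_f)) = π({∞, γ∞}_f)` for `γ ∈ Γ₀(N)` and every `σ ∈ Aut(ℂ/ℚ)`** (`X₁(N)`-datum `D` with `D.c = 1`; `{∞, γ∞}_f = cuspSymbol f γ`).
Stevens 1982 Thm. 1.3.1 (b) at the cusps of the `∞`-fibre: `γ′ = γT^t`, `t = δ(d−1)b`, has the same cusp `γ′∞ = γ∞` and
`γ′ ≡ diag(1,d′)γ diag(1,d) (mod N)`, so the Galois law on the translates of the rational presenting forms transports `π({∞,γ∞})` to itself.
[cite: Stevens1982, §1.3 Thm. 1.3.1 (b)] [cite: ShimuraIATAF1971, §6.2 Prop. 6.9] [cite: Manin1972, Prop. 1.4] -/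
theorem map_uniformize_cuspSymbol_eq_self {W : WeierstrassCurve ℚ} [W.IsElliptic] (D : Gamma1ParametrizationData W N) (hc : D.c = 1)
    (γ : Gamma0 N) (σ : ℂ ≃ₐ[ℚ] ℂ) :
    Affine.Point.map (W' := W) (σ : ℂ →ₐ[ℚ] ℂ) (D.uniformize (cuspSymbol D.f γ)) = D.uniformize (cuspSymbol D.f γ) := by
  classical
  set g : SL(2, ℤ) := (γ : SL(2, ℤ)) with hgdef
  by_cases h0 : (g 1 0 : ℤ) = 0
  · rw [cuspSymbol, ← hgdef, if_pos h0, map_zero, map_zero]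
  rw [cuspSymbol, ← hgdef, if_neg h0]
  -- the rational presenting pairs
  have hf : D.f ≠ 0 := D.isNewformOf.1.ne_zero
  obtain ⟨k, F, G, -, hG, hFG, hFr, hGr⟩ := StevensCurve.exists_rat_gamma1_presentation_of_gamma1Datum_one D hc
  obtain ⟨Fy, Gy, hGy, hFGy, -, -, hraty⟩ := StevensCurve.exists_gamma1_yPresentation D.f hf D.L F G hG hFG
  have hfr : ∀ n, ∃ q : ℚ, (q : ℂ) = cuspCoeff D.f n := fun n ↦
    ⟨(W.LFunction n : ℚ), by rw [D.isNewformOf.2 n, Rat.cast_intCast]⟩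
  obtain ⟨hFyr, hGyr⟩ := hraty hFr hGr hfr
  have hG0 : (⇑G : ℍ → ℂ) ≠ 0 := fun h ↦ hG (DFunLike.coe_fn_eq.mp (h.trans CuspForm.coe_zero.symm))
  have hGy0 : (⇑Gy : ℍ → ℂ) ≠ 0 := fun h ↦ hGy (DFunLike.coe_fn_eq.mp (h.trans CuspForm.coe_zero.symm))
  have hpresX : ∀ τ : ℍ, (1 : ℂ) * eichlerIntegral D.f τ ∉ D.L.lattice →
      G τ * ℘[D.L] ((1 : ℂ) * eichlerIntegral D.f τ) = F τ := fun τ hτ ↦ by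
    rw [one_mul] at hτ ⊢; rw [mul_comm]; exact hFG τ hτ
  have hpresY : ∀ τ : ℍ, (1 : ℂ) * eichlerIntegral D.f τ ∉ D.L.lattice →
      Gy τ * ℘'[D.L] ((1 : ℂ) * eichlerIntegral D.f τ) = Fy τ := fun τ hτ ↦ by
    rw [one_mul] at hτ ⊢; rw [mul_comm]; exact hFGy τ hτ
  -- the exponent pair of `σ` on `ζ_N`
  obtain ⟨d, d', hdd, hσ⟩ := StepTwo.exists_inv_pair_of_algEquiv (N := N) σ
  -- the companion matrix `γ' = γ T^t`, `t = δ(d-1)b`: same first column, congruent to `(a, db; d'c, δ)`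
  have hdet : (g 0 0 : ℤ) * g 1 1 - g 0 1 * g 1 0 = 1 := by
    have h := Matrix.SpecialLinearGroup.det_coe g
    rwa [Matrix.det_fin_two] at h
  set t : ℤ := g 1 1 * (d - 1) * g 0 1 with ht
  set g' : SL(2, ℤ) := ⟨!![g 0 0, g 0 0 * t + g 0 1; g 1 0, g 1 0 * t + g 1 1], by
    rw [Matrix.det_fin_two_of]; linear_combination hdet⟩ with hg'def
  have e00 : (g' 0 0 : ℤ) = g 0 0 := by simp [hg'def]
  have e01 : (g' 0 1 : ℤ) = g 0 0 * t + g 0 1 := by simp [hg'def]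
  have e10 : (g' 1 0 : ℤ) = g 1 0 := by simp [hg'def]
  have e11 : (g' 1 1 : ℤ) = g 1 0 * t + g 1 1 := by simp [hg'def]
  have hΓ0 : ((g 1 0 : ℤ) : ZMod N) = 0 := by
    have h := γ.2
    rw [Gamma0_mem] at h
    exact h
  have hunit : ((g 0 0 : ℤ) : ZMod N) * ((g 1 1 : ℤ) : ZMod N) = 1 := by
    have h := congrArg (fun z : ℤ ↦ (z : ZMod N)) hdet
    simp only [Int.cast_sub, Int.cast_mul, Int.cast_one, hΓ0, mul_zero, sub_zero] at h
    exact h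
  have h00 : ((g' 0 0 : ℤ) : ZMod N) = ((g 0 0 : ℤ) : ZMod N) := by rw [e00]
  have h01 : ((g' 0 1 : ℤ) : ZMod N) = (d : ZMod N) * ((g 0 1 : ℤ) : ZMod N) := by
    rw [e01, ht]; push_cast
    linear_combination ((d : ZMod N) - 1) * ((g 0 1 : ℤ) : ZMod N) * hunit
  have h10 : ((g' 1 0 : ℤ) : ZMod N) = (d' : ZMod N) * ((g 1 0 : ℤ) : ZMod N) := by rw [e10, hΓ0, mul_zero]
  have h11 : ((g' 1 1 : ℤ) : ZMod N) = ((g 1 1 : ℤ) : ZMod N) := by rw [e11]; push_cast; rw [hΓ0, zero_mul, zero_add]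
  have h0' : (g' 1 0 : ℤ) ≠ 0 := by rwa [e10]
  -- the Galois law on the translates of the four rational forms
  have hconj : ∀ {w : ℤ} (Φ : CuspForm (Gamma1 N) w), (∀ n, ∃ q : ℚ, (q : ℂ) = cuspCoeff Φ n) → ∀ n : ℕ,
      σ ((qExpansion ((N : ℕ) : ℝ) (⇑Φ ∣[w] g)).coeff n) = (qExpansion ((N : ℕ) : ℝ) (⇑Φ ∣[w] g')).coeff n := fun Φ hΦ n ↦ by
    rw [qExpansion_slash_conj_of_rat_cuspCoeff Φ hΦ (σ : ℂ →+* ℂ) hσ hdd h00 h01 h10 h11, coeff_map]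
    rfl
  have hσx : ∀ Φ : CuspForm (Gamma1 N) k, (Φ = F ∨ Φ = G) → ∀ n : ℕ,
      σ ((qExpansion ((N : ℕ) : ℝ) (⇑Φ ∣[k] g)).coeff n) = (qExpansion ((N : ℕ) : ℝ) (⇑Φ ∣[k] g')).coeff n := by
    rintro Φ (rfl | rfl) n
    exacts [hconj _ hFr n, hconj _ hGr n]
  have hσy : ∀ Φ : CuspForm (Gamma1 N) (k + (k + 2)), (Φ = Fy ∨ Φ = Gy) → ∀ n : ℕ,
      σ ((qExpansion ((N : ℕ) : ℝ) (⇑Φ ∣[k + (k + 2)] g)).coeff n) = (qExpansion ((N : ℕ) : ℝ) (⇑Φ ∣[k + (k + 2)] g')).coeff n := by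
    rintro Φ (rfl | rfl) n
    exacts [hconj _ hFyr n, hconj _ hGyr n]
  -- transport along `g ↦ g'`, and `g'∞ = g∞`
  have key := map_uniformize_cuspValue_of_galois_on_translates₂ D.L D.uniformize D.ker_uniformize D.uniformize_spec D.f hf one_ne_zero
    F G Fy Gy hG0 hGy0 hpresX hpresY g g' h0 h0' σ hσx hσy
  rwa [e00, e10, one_mul] at key

/-- **The value of an `X₁(N)`-parametrisation of Manin constant `1` at a cusp of the `∞`-fibre is a RATIONAL point**: for `γ ∈ Γ₀(N)`,
`π({∞, γ∞}_f) ∈ ι(W(ℚ))`. [cite: Stevens1982, §1.3 Thm. 1.3.1 (a), (b)] [cite: ConradEdixhovenStein2003, §6.1.2] -/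
theorem exists_ratPoint_eq_uniformize_cuspSymbol {W : WeierstrassCurve ℚ} [W.IsElliptic] (D : Gamma1ParametrizationData W N)
    (hc : D.c = 1) (γ : Gamma0 N) :
    ∃ P : (W.baseChange ℚ).toAffine.Point, Affine.Point.baseChange (W' := W) ℚ ℂ P = D.uniformize (cuspSymbol D.f γ) :=
  exists_ratPoint_of_forall_map_eq _ fun σ ↦ map_uniformize_cuspSymbol_eq_self D hc γ σ

/-- **THEOREM K, constancy half, for `X₁(N)`-data of Manin constant `1`: every `Γ₀(N)`-period uniformises to a RATIONAL point** —
`π(z) ∈ ι(W(ℚ))` for all `z ∈ Λ₀(f)` (`Λ₀(f)` is the set of cusp-to-cusp periods `{∞, γ∞}_f`, `γ ∈ Γ₀(N)`: `coe_periodLattice_eq_range`).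
No optimality is assumed. [cite: Stevens1982, §1.3 Thm. 1.3.1] [cite: Manin1972, Prop. 1.4 and Thm. 1.9] [cite: Stevens1989, §2] -/
theorem exists_ratPoint_eq_uniformize_of_mem_periodLattice {W : WeierstrassCurve ℚ} [W.IsElliptic] (D : Gamma1ParametrizationData W N)
    (hc : D.c = 1) (z : ℂ) (hz : z ∈ periodLattice D.f) :
    ∃ P : (W.baseChange ℚ).toAffine.Point, Affine.Point.baseChange (W' := W) ℚ ℂ P = D.uniformize z := by
  have hz' : z ∈ (periodLattice D.f : Set ℂ) := hz
  rw [coe_periodLattice_eq_range] at hz'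
  obtain ⟨γ, rfl⟩ := hz'
  exact exists_ratPoint_eq_uniformize_cuspSymbol D hc γ

/-- **E-es-207′ `Gamma1OptimalPeriodsRational` (es g41d, HOME/es/g41/Sketch-es-g41d.lean §10), VERBATIM, PROVED**: for an optimal `X₁(N)`-datum
`D₁` of Manin constant `1`, every `z ∈ Λ₀(f)` uniformises to the base change of a rational point of `W₁`.  (`IsOptimal` is not used.)  With es's
kernel-checked `primeLevel_rung_ledger'` the prime-level rung of the Derickx–Orlić question then rests on the Miyawaki–Setzer torsion fact alone.
[cite: Stevens1982, §1.3 Thm. 1.3.1] [cite: Stevens1989, §2 (1.4), (2.8)] -/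
theorem gamma1OptimalPeriodsRational :
    ∀ (W₁ : WeierstrassCurve ℚ) [W₁.IsElliptic] {N : ℕ} [NeZero N] (D₁ : Gamma1ParametrizationData W₁ N),
      D₁.IsOptimal → D₁.c = 1 → ∀ z ∈ periodLattice D₁.f, ∃ P : (W₁.baseChange ℚ).toAffine.Point,
        WeierstrassCurve.Affine.Point.baseChange (W' := W₁) ℚ ℂ P = D₁.uniformize z :=
  fun _ _ _ _ D₁ _ hc z hz ↦ exists_ratPoint_eq_uniformize_of_mem_periodLattice D₁ hc z hz

/-- **F-es-207 `StevensInfinityFibreCuspRational` for data of Manin constant `1`** (es g41d §11's shape with `D.c = 1` in place of `D.IsOptimal`):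
for a cusp `a/c` with `c ≠ 0`, `N ∣ c`, `gcd(a, c) = 1`, the value `π(c_D·{∞, a/c}_f)` is the base change of a rational point.
[cite: Stevens1982, §1.3 Thm. 1.3.1 (a), (b)] [cite: ConradEdixhovenStein2003, §6.1.2] -/
theorem stevensInfinityFibreCuspRational_of_c_eq_one {W : WeierstrassCurve ℚ} [W.IsElliptic] (D : Gamma1ParametrizationData W N)
    (hc1 : D.c = 1) (a c : ℤ) (hc : c ≠ 0) (hNc : (N : ℤ) ∣ c) (hac : IsCoprime a c) :
    ∃ P : (W.baseChange ℚ).toAffine.Point,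
      Affine.Point.baseChange (W' := W) ℚ ℂ P = D.uniformize ((D.c : ℂ) * modularSymbol D.f ((a : ℚ) / (c : ℚ))) := by
  obtain ⟨u, v, huv⟩ := hac
  set γ₀ : SL(2, ℤ) := ⟨!![a, -v; c, u], by rw [Matrix.det_fin_two_of]; linear_combination huv⟩ with hγ₀
  have hmem : γ₀ ∈ Gamma0 N := by
    rw [Gamma0_mem]
    simpa [hγ₀] using (ZMod.intCast_zmod_eq_zero_iff_dvd c N).mpr hNc
  obtain ⟨P, hP⟩ := exists_ratPoint_eq_uniformize_cuspSymbol D hc1 ⟨γ₀, hmem⟩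
  refine ⟨P, ?_⟩
  rw [hP, hc1, Int.cast_one, one_mul, cuspSymbol]
  have h10 : ((⟨γ₀, hmem⟩ : Gamma0 N) : SL(2, ℤ)) 1 0 = c := by simp [hγ₀]
  have h00 : ((⟨γ₀, hmem⟩ : Gamma0 N) : SL(2, ℤ)) 0 0 = a := by simp [hγ₀]
  rw [h10, h00, if_neg hc]

end Summit.BirchSwinnertonDyer.BirchSwinnertonDyer.Theorems.ManinLocalTwoThree.CuspValues

end
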